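import Summits.RiemannHypothesis.RiemannHypothesis.Theorems.PfPersistenceM2EffectiveThreshold
import HarnessLib

/-!
# Pf-persistence index route (M2): the effective even threshold for a DOMINANT extremal zero

pub-rhpf cell (M2 seat, generation 9).  HONEST FRAMING: long-odds MECHANISM SEARCH; no RH claims.
Every result in this file is RH-free and kernel-checked; none asserts or refutes RH.  Labels: PROVED.

Notation as in `PfPersistenceM2TranslationDefect` / `PfPersistenceM2EffectiveThreshold` (`Q`, `k̂`,
`P_k`, `m`, `g_T = 𝔰⟪k, T⟫`, `F(ρ,T) = 𝔉⟪ρ, T⟫ = cosh²((ρ-½)T)`, `δ = Re e - ½`, `γ = Im e`).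
The lone-quadruple (`K = 1`) threshold of `PfPersistenceM2EffectiveThreshold` is generalised to a
DOMINANT zero `e`: all other off-line zeros (the BYSTANDERS, a set `B`) lie in a strip
`|Re ρ - ½| ≤ θ` and have total weight `D ≥ Σ'_{ρ ∈ B} m(ρ)|P_k(ρ)|`.

PROVED here:
* (D1) `norm_coshSq_sub_one_le` — bystander weight bound `‖F(ρ,T) - 1‖ ≤ (cosh(2θT) + 1)/2` for
  `|Re ρ - ½| ≤ θ` (triangle inequality on the exponential form).
* (D2) `re_weilQuadratic_symShift_le_of_bystanders` — `Re Q(g_T) ≤ Re Q(k)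
  + 4 m(e) Re (P_k(e)(F(e,T) - 1)) + Σ'_ρ 1_B(ρ) ‖m(ρ) P_k(ρ) (F(ρ,T) - 1)‖` whenever every off-line
  zero lies in `B ∪ {e, ē, 1-e, 1-ē}` (on-line zeros only lower the energy, T2).
* (D3) `tsum_indicator_defect_le` — the bystander sum is `≤ (cosh(2θT)+1)/2 · Σ'_ρ 1_B(ρ) m(ρ)|P_k(ρ)|`.
* (D4) `evenNegIndexAtLeast_one_of_dominant` — THRESHOLD CRITERION: `k` even real in `[-a,a]`,
  `T ≥ 0` tuned, `Re Q(k) + (cosh(2θT)+1)/2 · D < 2 m(e)|P_k(e)|(sinh(2δT) - 1)` ⟹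
  `EvenNegIndexAtLeast 1 (a + T)`.
* (D5) `dominant_zero_invisible_of_not_evenNegIndexAtLeast` — RIGIDITY READING: if `[-A, A]`
  carries no even negative direction (`a + π/γ ≤ A`), then
  `2 m(e)|P_k(e)| (sinh(2δ(A - a - π/γ)) - 1) ≤ Re Q(k) + (cosh(2θ(A - a)) + 1)/2 · D`.
* (D6) `sInf_evenNegIndexAtLeast_one_le_of_dominant` — THE EXPLICIT BOUND under `0 ≤ θ ≤ δ` and
  WEIGHT DOMINANCE `D < 2 m(e)|P_k(e)|`:
  `a₁^{ev} ≤ a + max(0, log((Re Q(k) + D/2 + 3m(e)|P_k(e)|)/(m(e)|P_k(e)| - D/2))/(2δ)) + π/γ`.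

HONEST READING.  Effectivity is bought by DOMINANCE: with no hypothesis on the bystanders their
amplification `cosh²((β-½)T) ≤ e^{T}` can outgrow the gain `e^{2δT}` of the extremal zero, and only
the ineffective `∃ᶠ` statements of the tree survive (Littlewood's theorem needs no dominance but gives
no window).  When `θ < δ` the criterion (D4) is met for all large tuned `T`; when `θ = δ` it is met
eventually iff `D < 4 m(e)|P_k(e)|`.  `B = ∅` recovers the `K = 1` file.  The ε₁-floor / RH-strength
input is untouched; under RH all hypotheses are vacuous.  HONEST GRADE: VARIANT (effective
Landau–Littlewood with a dominant term) [cite: MontgomeryVaughan2007,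
Thm. 15.3, 15.8] [cite: Bombieri2000Weil, §5].  mechanism/rigidity campaign; no RH claims.
-/

noncomputable section

set_option linter.dupNamespace false

open Complex Filter Set MeasureTheory
open scoped Real Topology ComplexConjugate BigOperators

namespace Summit.RiemannHypothesis.RiemannHypothesis.Theorems.PfPersistenceM2NegIndex

open Literature.NumberTheory.LFunctions
open Literature.NumberTheory.LFunctions.WeilConverse
open Literature.NumberTheory.LFunctions.ZetaZeros
open Summit.RiemannHypothesis.RiemannHypothesis.Theorems.RuelleBandExactFirstBand

/-- `𝔰⟪k, T⟫ = g_T`, the symmetric translate `t ↦ (k(t - T) + k(t + T)) / 2`. -/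
local notation "𝔰⟪" k ", " T "⟫" => fun t : ℝ => (k (t - T) + k (t + T)) / 2

/-- `𝔉⟪ρ, T⟫ = F(ρ,T) = (e^{(ρ-½)2T} + e^{(½-ρ)2T} + 2)/4 = cosh²((ρ-½)T)`. -/
local notation "𝔉⟪" ρ ", " T "⟫" =>
  (cexp ((ρ - 1 / 2) * ((2 * T : ℝ) : ℂ)) + cexp ((1 / 2 - ρ) * ((2 * T : ℝ) : ℂ)) + 2) / 4

/-! ## (D1) The bystander weight bound -/

/-- **(D1)** `‖F(ρ,T) - 1‖ ≤ (cosh(2θT) + 1)/2` when `|Re ρ - ½| ≤ θ`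
(`F - 1 = (e^{w} + e^{-w} - 2)/4`, `w = (ρ-½)2T`, `|Re w| ≤ 2θ|T|`). -/
theorem norm_coshSq_sub_one_le {ρ : ℂ} {θ : ℝ} (hρ : |ρ.re - 1 / 2| ≤ θ) (T : ℝ) :
    ‖𝔉⟪ρ, T⟫ - 1‖ ≤ (Real.cosh (2 * θ * T) + 1) / 2 := by
  have hθ0 : 0 ≤ θ := (abs_nonneg _).trans hρ
  set w : ℂ := (ρ - 1 / 2) * ((2 * T : ℝ) : ℂ) with hw
  have hw' : (1 / 2 - ρ) * ((2 * T : ℝ) : ℂ) = -w := by rw [hw]; ring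
  have hwre : w.re = (ρ.re - 1 / 2) * (2 * T) := by
    simp [hw, Complex.mul_re]
  have h1 : 𝔉⟪ρ, T⟫ - 1 = (cexp w + cexp (-w) - 2) / 4 := by
    rw [hw', ← hw]; ring
  have hcosh : Real.cosh w.re ≤ Real.cosh (2 * θ * T) := by
    rw [Real.cosh_le_cosh, hwre]
    calc |(ρ.re - 1 / 2) * (2 * T)| = |ρ.re - 1 / 2| * |2 * T| := abs_mul _ _
      _ ≤ θ * |2 * T| := mul_le_mul_of_nonneg_right hρ (abs_nonneg _)
      _ = |2 * θ * T| := by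
          rw [show (2 : ℝ) * θ * T = θ * (2 * T) by ring, abs_mul θ (2 * T), abs_of_nonneg hθ0]
  calc ‖𝔉⟪ρ, T⟫ - 1‖ = ‖cexp w + cexp (-w) - 2‖ / 4 := by
        rw [h1, norm_div]; norm_num
    _ ≤ (‖cexp w‖ + ‖cexp (-w)‖ + 2) / 4 := by
        have h2 := norm_sub_le (cexp w + cexp (-w)) (2 : ℂ)
        have h3 := norm_add_le (cexp w) (cexp (-w))
        have h4 : ‖(2 : ℂ)‖ = 2 := Complex.norm_two
        linarith
    _ = (Real.cosh w.re + 1) / 2 := by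
        rw [Complex.norm_exp, Complex.norm_exp, Complex.neg_re, Real.cosh_eq]; ring
    _ ≤ (Real.cosh (2 * θ * T) + 1) / 2 := by linarith

/-! ## (D2) The comparison with bystanders -/

/-- **(D2) Translation comparison for a dominant zero.** If every off-line zero lies in
`B ∪ {e, ē, 1-e, 1-ē}` (`Re e > ½`, `k` even real), then for every `T`
`Re Q(g_T) ≤ Re Q(k) + 4 m(e) Re (P_k(e)(F(e,T) - 1)) + Σ'_ρ 1_B(ρ) ‖m(ρ) P_k(ρ)(F(ρ,T) - 1)‖`. -/
theorem re_weilQuadratic_symShift_le_of_bystanders {k : ℝ → ℂ} (hk : IsWeilTest k)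
    (hev : ∀ t : ℝ, k (-t) = k t) (hre : ∀ t : ℝ, (k t).im = 0) {e : ℂ}
    (he : e ∈ riemannZetaNontrivialZeros) (hδ : 1 / 2 < e.re) {B : Set ℂ}
    (hB : ∀ ρ ∈ riemannZetaNontrivialZeros,
      ρ.re ≠ 1 / 2 → ρ ∈ B ∨ ρ = e ∨ ρ = conj e ∨ ρ = 1 - e ∨ ρ = 1 - conj e) (T : ℝ) :
    (weilQuadratic (𝔰⟪k, T⟫)).re ≤ (weilQuadratic k).re +
      4 * (riemannZetaZeroOrder e * (pairCoeff k e * (𝔉⟪e, T⟫ - 1)).re) +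
      ∑' ρ : riemannZetaNontrivialZeros, B.indicator
        (fun z : ℂ ↦ ‖(riemannZetaZeroOrder z : ℂ) * pairCoeff k z * (𝔉⟪z, T⟫ - 1)‖) ρ := by
  set F : ℂ → ℝ := fun ρ ↦
    ((riemannZetaZeroOrder ρ : ℂ) * pairCoeff k ρ * (𝔉⟪ρ, T⟫ - 1)).re with hF
  set N : ℂ → ℝ := fun ρ ↦
    ‖(riemannZetaZeroOrder ρ : ℂ) * pairCoeff k ρ * (𝔉⟪ρ, T⟫ - 1)‖ with hN
  have hdiff : (weilQuadratic (𝔰⟪k, T⟫)).re - (weilQuadratic k).re =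
      ∑' ρ : riemannZetaNontrivialZeros, F ρ := re_weilQuadratic_symShift_sub hk T
  have hsF : Summable fun ρ : riemannZetaNontrivialZeros ↦ F ρ := by
    simpa [hF] using Complex.reCLM.summable (summable_defect hk T)
  have hsN : Summable fun ρ : riemannZetaNontrivialZeros ↦ N ρ := by
    simpa [hN] using summable_norm_iff.mpr (summable_defect hk T)
  have hN0 : ∀ z, 0 ≤ N z := fun z ↦ norm_nonneg _
  have hsI : Summable fun ρ : riemannZetaNontrivialZeros ↦ B.indicator N ρ :=
    hsN.of_norm_bounded fun ρ ↦ by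
      rw [Real.norm_eq_abs, abs_of_nonneg (Set.indicator_nonneg (fun z _ ↦ hN0 z) _)]
      exact Set.indicator_apply_le' (fun _ ↦ le_rfl) (fun _ ↦ hN0 _)
  have h0 : 0 < e.re := by linarith
  have h1 : e.re < 1 := riemannZetaNontrivialZeros.re_lt_one he
  have him : e.im ≠ 0 := riemannZetaNontrivialZeros.im_ne_zero he
  have hce : conj e ∈ riemannZetaNontrivialZeros := riemannZetaNontrivialZeros.conj_mem he
  have h1e : 1 - e ∈ riemannZetaNontrivialZeros := by
    simpa using riemannZetaNontrivialZeros.one_sub_conj_mem hce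
  have h1ce : 1 - conj e ∈ riemannZetaNontrivialZeros :=
    riemannZetaNontrivialZeros.one_sub_conj_mem he
  have hFe : F e = riemannZetaZeroOrder e * (pairCoeff k e * (𝔉⟪e, T⟫ - 1)).re := by
    simp only [hF]
    rw [mul_assoc, ← Complex.ofReal_intCast, Complex.re_ofReal_mul]
  have hFce : F (conj e) = F e := by
    simp only [hF]; exact re_defect_conj hev hre e T
  have hF1e : F (1 - e) = F e := by
    simp only [hF]; exact re_defect_one_sub hev h0 h1 T
  have hF1ce : F (1 - conj e) = F e := by
    rw [← hFce]; simp only [hF]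
    exact re_defect_one_sub hev (by simpa using h0) (by simpa using h1) T
  set S : Finset riemannZetaNontrivialZeros :=
    {⟨e, he⟩, ⟨conj e, hce⟩, ⟨1 - e, h1e⟩, ⟨1 - conj e, h1ce⟩} with hS
  have hmemS : ∀ ρ : riemannZetaNontrivialZeros, (ρ : ℂ).re ≠ 1 / 2 → (ρ : ℂ) ∉ B → ρ ∈ S := by
    intro ρ hρ hρB
    rcases hB ρ ρ.2 hρ with h | h | h | h | h
    · exact absurd h hρB
    · rw [show ρ = ⟨e, he⟩ from Subtype.ext h, hS]; simp
    · rw [show ρ = ⟨conj e, hce⟩ from Subtype.ext h, hS]; simp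
    · rw [show ρ = ⟨1 - e, h1e⟩ from Subtype.ext h, hS]; simp
    · rw [show ρ = ⟨1 - conj e, h1ce⟩ from Subtype.ext h, hS]; simp
  -- comparison function: exact on the quadruple, the norm on the bystanders, zero on the line
  set g : riemannZetaNontrivialZeros → ℝ := fun ρ ↦
    (if ρ ∈ S then F ρ else 0) + B.indicator N ρ with hg
  have hfin0 : ∀ ρ ∉ S, (fun ρ : riemannZetaNontrivialZeros ↦ if ρ ∈ S then F ρ else 0) ρ = 0 :=
    fun ρ hρ ↦ if_neg hρ
  have hsfin : Summable fun ρ : riemannZetaNontrivialZeros ↦ (if ρ ∈ S then F ρ else 0) :=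
    summable_of_ne_finset_zero hfin0
  have hle : ∀ ρ : riemannZetaNontrivialZeros, F ρ ≤ g ρ := by
    intro ρ
    have hI0 : 0 ≤ B.indicator N ρ := Set.indicator_nonneg (fun z _ ↦ hN0 z) _
    by_cases hρ : ρ ∈ S
    · simp only [hg, if_pos hρ]; linarith
    · simp only [hg, if_neg hρ, zero_add]
      by_cases hline : (ρ : ℂ).re = 1 / 2
      · exact (re_defect_nonpos_of_re_eq_half k ρ.2 hline T).trans hI0
      · have hρB : (ρ : ℂ) ∈ B := by
          by_contra hρB
          exact hρ (hmemS ρ hline hρB)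
        rw [Set.indicator_of_mem hρB]
        exact Complex.re_le_norm _
  have hne12 : e ≠ conj e := fun h ↦ him (by have := congrArg Complex.im h; simp at this; linarith)
  have hne13 : e ≠ 1 - e := fun h ↦ by have := congrArg Complex.re h; simp at this; linarith
  have hne14 : e ≠ 1 - conj e := fun h ↦ by have := congrArg Complex.re h; simp at this; linarith
  have hne23 : conj e ≠ 1 - e := fun h ↦ by have := congrArg Complex.re h; simp at this; linarith
  have hne24 : conj e ≠ 1 - conj e := fun h ↦ by
    have := congrArg Complex.re h; simp at this; linarith
  have hne34 : 1 - e ≠ 1 - conj e := fun h ↦ him (by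
    have := congrArg Complex.im h; simp at this; linarith)
  have hsumS : ∑ ρ ∈ S, F ρ = 4 * F e := by
    rw [hS, Finset.sum_insert, Finset.sum_insert,
      Finset.sum_pair (fun h ↦ hne34 (congrArg Subtype.val h))]
    · show F e + (F (conj e) + (F (1 - e) + F (1 - conj e))) = 4 * F e
      rw [hFce, hF1e, hF1ce]; ring
    · simp only [Finset.mem_insert, Finset.mem_singleton, Subtype.mk.injEq, not_or]
      exact ⟨hne23, hne24⟩
    · simp only [Finset.mem_insert, Finset.mem_singleton, Subtype.mk.injEq, not_or]
      exact ⟨hne12, hne13, hne14⟩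
  have htsum : ∑' ρ : riemannZetaNontrivialZeros, F ρ ≤
      4 * F e + ∑' ρ : riemannZetaNontrivialZeros, B.indicator N ρ :=
    calc ∑' ρ : riemannZetaNontrivialZeros, F ρ ≤ ∑' ρ, g ρ :=
          hsF.tsum_le_tsum hle (hsfin.add hsI)
      _ = ∑' ρ : riemannZetaNontrivialZeros, (if ρ ∈ S then F ρ else 0) +
            ∑' ρ : riemannZetaNontrivialZeros, B.indicator N ρ := hsfin.tsum_add hsI
      _ = 4 * F e + ∑' ρ : riemannZetaNontrivialZeros, B.indicator N ρ := by
          rw [tsum_eq_sum hfin0, Finset.sum_congr rfl fun ρ hρ ↦ if_pos hρ, hsumS]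
  linarith [hdiff, htsum, hFe]

/-! ## (D3) Bounding the bystander sum -/

/-- The bystander norm series `Σ'_ρ 1_B(ρ) m(ρ)|P_k(ρ)|` converges. -/
theorem summable_indicator_norm_pairCoeff {k : ℝ → ℂ} (hk : IsWeilTest k) (B : Set ℂ) :
    Summable fun ρ : riemannZetaNontrivialZeros ↦
      B.indicator (fun z : ℂ ↦ ‖(riemannZetaZeroOrder z : ℂ) * pairCoeff k z‖) ρ :=
  (summable_norm_pairCoeff hk).of_norm_bounded fun ρ ↦ by
    rw [Real.norm_eq_abs, abs_of_nonneg (Set.indicator_nonneg (fun z _ ↦ norm_nonneg _) _)]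
    exact Set.indicator_apply_le' (fun _ ↦ le_rfl) (fun _ ↦ norm_nonneg _)

/-- **(D3)** If `|Re ρ - ½| ≤ θ` on `B`, then
`Σ'_ρ 1_B(ρ) ‖m(ρ) P_k(ρ)(F(ρ,T) - 1)‖ ≤ (cosh(2θT)+1)/2 · Σ'_ρ 1_B(ρ) m(ρ)|P_k(ρ)|`. -/
theorem tsum_indicator_defect_le {k : ℝ → ℂ} (hk : IsWeilTest k) {B : Set ℂ} {θ : ℝ}
    (hθ : ∀ z ∈ B, |z.re - 1 / 2| ≤ θ) (T : ℝ) :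
    ∑' ρ : riemannZetaNontrivialZeros, B.indicator
        (fun z : ℂ ↦ ‖(riemannZetaZeroOrder z : ℂ) * pairCoeff k z * (𝔉⟪z, T⟫ - 1)‖) ρ ≤
      (Real.cosh (2 * θ * T) + 1) / 2 * ∑' ρ : riemannZetaNontrivialZeros, B.indicator
        (fun z : ℂ ↦ ‖(riemannZetaZeroOrder z : ℂ) * pairCoeff k z‖) ρ := by
  have hc : 0 ≤ (Real.cosh (2 * θ * T) + 1) / 2 := by
    have := Real.cosh_pos (2 * θ * T); positivity
  have hsN : Summable fun ρ : riemannZetaNontrivialZeros ↦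
      ‖(riemannZetaZeroOrder (ρ : ℂ) : ℂ) * pairCoeff k ρ * (𝔉⟪(ρ : ℂ), T⟫ - 1)‖ :=
    summable_norm_iff.mpr (summable_defect hk T)
  have hsI : Summable fun ρ : riemannZetaNontrivialZeros ↦ B.indicator
      (fun z : ℂ ↦ ‖(riemannZetaZeroOrder z : ℂ) * pairCoeff k z * (𝔉⟪z, T⟫ - 1)‖) ρ :=
    hsN.of_norm_bounded fun ρ ↦ by
      rw [Real.norm_eq_abs, abs_of_nonneg (Set.indicator_nonneg (fun z _ ↦ norm_nonneg _) _)]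
      exact Set.indicator_apply_le' (fun _ ↦ le_rfl) (fun _ ↦ norm_nonneg _)
  rw [← tsum_mul_left]
  refine hsI.tsum_le_tsum (fun ρ ↦ ?_) ((summable_indicator_norm_pairCoeff hk B).mul_left _)
  by_cases hρ : (ρ : ℂ) ∈ B
  · rw [Set.indicator_of_mem hρ, Set.indicator_of_mem hρ, norm_mul, mul_comm]
    exact mul_le_mul_of_nonneg_right (norm_coshSq_sub_one_le (hθ _ hρ) T) (norm_nonneg _)
  · rw [Set.indicator_of_notMem hρ, Set.indicator_of_notMem hρ, mul_zero]

/-! ## (D4) The threshold criterion for a dominant zero -/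

/-- **(D4) Effective even threshold for a dominant extremal zero.** `k` even real in `[-a,a]`,
every off-line zero in `B ∪ {e, ē, 1-e, 1-ē}`, the bystanders `B` inside the strip `|Re ρ - ½| ≤ θ`
with total weight `Σ'_ρ 1_B(ρ) m(ρ)|P_k(ρ)| ≤ D`; if `T ≥ 0` is tuned (`P_k(e) e^{2iγT} = -|P_k(e)|`) and
`Re Q(k) + (cosh(2θT)+1)/2 · D < 2 m(e)|P_k(e)|(sinh(2δT) - 1)`, then `[-(a+T), a+T]` carries an even
negative direction.  (`B = ∅`, `D = 0` is the lone-quadruple criterion.) -/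
theorem evenNegIndexAtLeast_one_of_dominant {k : ℝ → ℂ} (hk : IsWeilTest k)
    (hev : ∀ t : ℝ, k (-t) = k t) (hre : ∀ t : ℝ, (k t).im = 0) {a : ℝ}
    (hsupp : tsupport k ⊆ Icc (-a) a) {e : ℂ} (he : e ∈ riemannZetaNontrivialZeros)
    (hδ : 1 / 2 < e.re) {B : Set ℂ}
    (hB : ∀ ρ ∈ riemannZetaNontrivialZeros,
      ρ.re ≠ 1 / 2 → ρ ∈ B ∨ ρ = e ∨ ρ = conj e ∨ ρ = 1 - e ∨ ρ = 1 - conj e)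
    {θ D : ℝ} (hθ : ∀ z ∈ B, |z.re - 1 / 2| ≤ θ)
    (hD : ∑' ρ : riemannZetaNontrivialZeros, B.indicator
        (fun z : ℂ ↦ ‖(riemannZetaZeroOrder z : ℂ) * pairCoeff k z‖) ρ ≤ D)
    {T : ℝ} (hT : 0 ≤ T)
    (htune : pairCoeff k e * cexp (((e.im * (2 * T) : ℝ) : ℂ) * I) = -(‖pairCoeff k e‖ : ℂ))
    (hbig : (weilQuadratic k).re + (Real.cosh (2 * θ * T) + 1) / 2 * D <
      2 * riemannZetaZeroOrder e * ‖pairCoeff k e‖ * (Real.sinh (2 * (e.re - 1 / 2) * T) - 1)) :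
    EvenNegIndexAtLeast 1 (a + T) := by
  have h3 := re_weilQuadratic_symShift_le_of_bystanders hk hev hre he hδ hB T
  have h5 := tsum_indicator_defect_le hk hθ T
  have h4 := re_mul_coshSq_sub_one_le htune
  have hm : (0 : ℝ) ≤ riemannZetaZeroOrder e := by
    have : (1 : ℝ) ≤ riemannZetaZeroOrder e := by
      exact_mod_cast riemannZetaNontrivialZeros.one_le_order he
    linarith
  have hc : 0 ≤ (Real.cosh (2 * θ * T) + 1) / 2 := by
    have := Real.cosh_pos (2 * θ * T); positivity
  have h6 := mul_le_mul_of_nonneg_left hD hc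
  refine evenNegIndexAtLeast_one_of_neg (isWeilTest_symTranslate hk T) (symTranslate_even hev T)
    (symTranslate_im hre T) (tsupport_symTranslate_subset hsupp hT) ?_
  nlinarith [mul_le_mul_of_nonneg_left h4 hm]

/-! ## (D5) Rigidity reading: persistence of even positivity hides a dominant zero -/

/-- **(D5)** If `[-A, A]` carries NO even negative direction (`a + π/γ ≤ A`), then for every even
real Weil test `k` in `[-a,a]` and every dominant configuration as in (D4):
`2 m(e)|P_k(e)| (sinh(2δ(A - a - π/γ)) - 1) ≤ Re Q(k) + (cosh(2θ(A - a)) + 1)/2 · D`. -/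
theorem dominant_zero_invisible_of_not_evenNegIndexAtLeast {k : ℝ → ℂ} (hk : IsWeilTest k)
    (hev : ∀ t : ℝ, k (-t) = k t) (hre : ∀ t : ℝ, (k t).im = 0) {a : ℝ}
    (hsupp : tsupport k ⊆ Icc (-a) a) {e : ℂ} (he : e ∈ riemannZetaNontrivialZeros)
    (hδ : 1 / 2 < e.re) (hγ : 0 < e.im) {B : Set ℂ}
    (hB : ∀ ρ ∈ riemannZetaNontrivialZeros,
      ρ.re ≠ 1 / 2 → ρ ∈ B ∨ ρ = e ∨ ρ = conj e ∨ ρ = 1 - e ∨ ρ = 1 - conj e)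
    {θ D : ℝ} (hθ : ∀ z ∈ B, |z.re - 1 / 2| ≤ θ)
    (hD : ∑' ρ : riemannZetaNontrivialZeros, B.indicator
        (fun z : ℂ ↦ ‖(riemannZetaZeroOrder z : ℂ) * pairCoeff k z‖) ρ ≤ D)
    {A : ℝ} (hA : ¬ EvenNegIndexAtLeast 1 A) (haA : a + π / e.im ≤ A) :
    2 * riemannZetaZeroOrder e * ‖pairCoeff k e‖ *
        (Real.sinh (2 * (e.re - 1 / 2) * (A - a - π / e.im)) - 1) ≤
      (weilQuadratic k).re + (Real.cosh (2 * θ * (A - a)) + 1) / 2 * D := by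
  by_contra hlt
  rw [not_le] at hlt
  have hπγ : 0 < π / e.im := div_pos Real.pi_pos hγ
  have hD0 : 0 ≤ D :=
    (tsum_nonneg fun ρ ↦ Set.indicator_nonneg (fun z _ ↦ norm_nonneg _) _).trans hD
  have hm : (0 : ℝ) ≤ riemannZetaZeroOrder e := by
    have : (1 : ℝ) ≤ riemannZetaZeroOrder e := by
      exact_mod_cast riemannZetaNontrivialZeros.one_le_order he
    linarith
  obtain ⟨T, ⟨hT1, hT2⟩, htune⟩ := exists_tuned (pairCoeff k e) hγ (A - a - π / e.im)
  have hT0 : 0 ≤ T := by linarith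
  have hTA : T ≤ A - a := by linarith
  have hmono : Real.sinh (2 * (e.re - 1 / 2) * (A - a - π / e.im)) ≤
      Real.sinh (2 * (e.re - 1 / 2) * T) :=
    Real.sinh_le_sinh.2 (mul_le_mul_of_nonneg_left hT1 (by linarith))
  have hcosh : Real.cosh (2 * θ * T) ≤ Real.cosh (2 * θ * (A - a)) := by
    rw [Real.cosh_le_cosh]
    calc |2 * θ * T| = |2 * θ| * T := by rw [abs_mul, abs_of_nonneg hT0]
      _ ≤ |2 * θ| * (A - a) := mul_le_mul_of_nonneg_left hTA (abs_nonneg _)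
      _ = |2 * θ * (A - a)| := by rw [abs_mul (2 * θ), abs_of_nonneg (hT0.trans hTA)]
  have hcD : (Real.cosh (2 * θ * T) + 1) / 2 * D ≤ (Real.cosh (2 * θ * (A - a)) + 1) / 2 * D :=
    mul_le_mul_of_nonneg_right (by linarith) hD0
  have hbig : (weilQuadratic k).re + (Real.cosh (2 * θ * T) + 1) / 2 * D <
      2 * riemannZetaZeroOrder e * ‖pairCoeff k e‖ * (Real.sinh (2 * (e.re - 1 / 2) * T) - 1) :=
    calc (weilQuadratic k).re + (Real.cosh (2 * θ * T) + 1) / 2 * D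
        ≤ (weilQuadratic k).re + (Real.cosh (2 * θ * (A - a)) + 1) / 2 * D := by linarith
      _ < 2 * riemannZetaZeroOrder e * ‖pairCoeff k e‖ *
            (Real.sinh (2 * (e.re - 1 / 2) * (A - a - π / e.im)) - 1) := hlt
      _ ≤ 2 * riemannZetaZeroOrder e * ‖pairCoeff k e‖ *
            (Real.sinh (2 * (e.re - 1 / 2) * T) - 1) :=
          mul_le_mul_of_nonneg_left (by linarith) (by positivity)
  have hidx := evenNegIndexAtLeast_one_of_dominant hk hev hre hsupp he hδ hB hθ hD hT0 htune hbig
  exact hA (hidx.mono (by linarith))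

/-! ## (D6) The explicit threshold under weight dominance -/

/-- **(D6) Explicit even threshold for a dominant zero.** In the configuration of (D4) with the
bystander strip inside the one of `e` (`0 ≤ θ ≤ δ`) and WEIGHT DOMINANCE `D < 2 m(e)|P_k(e)|`:
`a₁^{ev} ≤ a + max(0, log((Re Q(k) + D/2 + 3 m(e)|P_k(e)|) / (m(e)|P_k(e)| - D/2)) / (2δ)) + π/γ`.
(`cosh(2θT) ≤ e^{2δT}`, `sinh(2δT) ≥ (e^{2δT} - 1)/2`; `D = 0` is the `K = 1` bound up to the
shape of the logarithm.) -/
theorem sInf_evenNegIndexAtLeast_one_le_of_dominant {k : ℝ → ℂ} (hk : IsWeilTest k)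
    (hev : ∀ t : ℝ, k (-t) = k t) (hre : ∀ t : ℝ, (k t).im = 0) {a : ℝ}
    (hsupp : tsupport k ⊆ Icc (-a) a) {e : ℂ} (he : e ∈ riemannZetaNontrivialZeros)
    (hδ : 1 / 2 < e.re) (hγ : 0 < e.im) {B : Set ℂ}
    (hB : ∀ ρ ∈ riemannZetaNontrivialZeros,
      ρ.re ≠ 1 / 2 → ρ ∈ B ∨ ρ = e ∨ ρ = conj e ∨ ρ = 1 - e ∨ ρ = 1 - conj e)
    {θ D : ℝ} (hθ : ∀ z ∈ B, |z.re - 1 / 2| ≤ θ) (hθ0 : 0 ≤ θ) (hθδ : θ ≤ e.re - 1 / 2)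
    (hD : ∑' ρ : riemannZetaNontrivialZeros, B.indicator
        (fun z : ℂ ↦ ‖(riemannZetaZeroOrder z : ℂ) * pairCoeff k z‖) ρ ≤ D)
    (hDP : D < 2 * (riemannZetaZeroOrder e * ‖pairCoeff k e‖)) :
    sInf {a' : ℝ | EvenNegIndexAtLeast 1 a'} ≤
      a + max 0 (Real.log (((weilQuadratic k).re + D / 2 +
          3 * (riemannZetaZeroOrder e * ‖pairCoeff k e‖)) /
          (riemannZetaZeroOrder e * ‖pairCoeff k e‖ - D / 2)) / (2 * (e.re - 1 / 2))) +
        π / e.im := by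
  set M : ℝ := riemannZetaZeroOrder e * ‖pairCoeff k e‖ with hM
  set R : ℝ := Real.log (((weilQuadratic k).re + D / 2 + 3 * M) / (M - D / 2)) /
    (2 * (e.re - 1 / 2)) with hR
  have hπγ : 0 < π / e.im := div_pos Real.pi_pos hγ
  have hD0 : 0 ≤ D :=
    (tsum_nonneg fun ρ ↦ Set.indicator_nonneg (fun z _ ↦ norm_nonneg _) _).trans hD
  have hden : 0 < M - D / 2 := by linarith
  have hM0 : 0 ≤ M := by linarith
  -- if `Re Q(k) < 0` the window `[-a, a]` already carries a negative direction
  by_cases hQ : (weilQuadratic k).re < 0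
  · calc sInf {a' : ℝ | EvenNegIndexAtLeast 1 a'} ≤ a :=
          csInf_le (bddBelow_setOf_evenNegIndexAtLeast_succ 0)
            (evenNegIndexAtLeast_one_of_neg hk hev hre hsupp hQ)
      _ ≤ a + max 0 R + π / e.im := by linarith [le_max_left 0 R]
  rw [not_lt] at hQ
  have hnum : 0 < (weilQuadratic k).re + D / 2 + 3 * M := by linarith
  have hq : 0 < ((weilQuadratic k).re + D / 2 + 3 * M) / (M - D / 2) := div_pos hnum hden
  refine le_of_forall_pos_le_add fun ε hε ↦ ?_
  obtain ⟨T, ⟨hT1, hT2⟩, htune⟩ := exists_tuned (pairCoeff k e) hγ (max 0 R + ε)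
  have hT0 : 0 ≤ T := by linarith [le_max_left 0 R]
  have hδ2 : 0 < 2 * (e.re - 1 / 2) := by linarith
  set x : ℝ := Real.exp (2 * (e.re - 1 / 2) * T) with hx
  -- `T > R` gives `x (M - D/2) > Re Q(k) + D/2 + 3M`
  have hxq : ((weilQuadratic k).re + D / 2 + 3 * M) / (M - D / 2) < x := by
    have hRT : R < T := by linarith [le_max_right 0 R]
    rw [hR, div_lt_iff₀ hδ2] at hRT
    have := Real.exp_lt_exp.2 hRT
    rwa [Real.exp_log hq, show T * (2 * (e.re - 1 / 2)) = 2 * (e.re - 1 / 2) * T by ring] at this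
  have hx1 : (weilQuadratic k).re + D / 2 + 3 * M < x * (M - D / 2) := by
    have := mul_lt_mul_of_pos_right hxq hden
    rwa [div_mul_cancel₀ _ hden.ne'] at this
  -- elementary bounds: `cosh(2θT) ≤ cosh(2δT) ≤ x`, `sinh(2δT) ≥ (x - 1)/2`
  have hy0 : 0 ≤ 2 * (e.re - 1 / 2) * T := by positivity
  have hcosh1 : Real.cosh (2 * θ * T) ≤ Real.cosh (2 * (e.re - 1 / 2) * T) := by
    rw [Real.cosh_le_cosh, abs_of_nonneg (by positivity), abs_of_nonneg hy0]
    exact mul_le_mul_of_nonneg_right (by linarith) hT0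
  have hcosh2 : Real.cosh (2 * (e.re - 1 / 2) * T) ≤ x := by
    rw [Real.cosh_eq, hx]
    have := Real.exp_le_exp.2 (show -(2 * (e.re - 1 / 2) * T) ≤ 2 * (e.re - 1 / 2) * T by linarith)
    linarith
  have hsinh : (x - 1) / 2 ≤ Real.sinh (2 * (e.re - 1 / 2) * T) := by
    rw [Real.sinh_eq, hx]
    have := Real.exp_le_one_iff.2 (show -(2 * (e.re - 1 / 2) * T) ≤ 0 by linarith)
    linarith
  have h7 : (Real.cosh (2 * θ * T) + 1) / 2 * D ≤ (x + 1) / 2 * D :=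
    mul_le_mul_of_nonneg_right (by linarith) hD0
  have h8 : 2 * M * ((x - 1) / 2 - 1) ≤ 2 * M * (Real.sinh (2 * (e.re - 1 / 2) * T) - 1) :=
    mul_le_mul_of_nonneg_left (by linarith) (by positivity)
  have hbig : (weilQuadratic k).re + (Real.cosh (2 * θ * T) + 1) / 2 * D <
      2 * riemannZetaZeroOrder e * ‖pairCoeff k e‖ * (Real.sinh (2 * (e.re - 1 / 2) * T) - 1) := by
    rw [show 2 * (riemannZetaZeroOrder e : ℝ) * ‖pairCoeff k e‖ = 2 * M by rw [hM]; ring]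
    nlinarith
  have hidx := evenNegIndexAtLeast_one_of_dominant hk hev hre hsupp he hδ hB hθ hD hT0 htune hbig
  calc sInf {a' : ℝ | EvenNegIndexAtLeast 1 a'} ≤ a + T :=
        csInf_le (bddBelow_setOf_evenNegIndexAtLeast_succ 0) hidx
    _ ≤ a + max 0 R + π / e.im + ε := by linarith

end Summit.RiemannHypothesis.RiemannHypothesis.Theorems.PfPersistenceM2NegIndex
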